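import Literature.Barriers.QuantumFields.NoUltralocalGinspargWilsonLemmas
import Mathlib.Analysis.SpecialFunctions.ExpDeriv
import Mathlib.Analysis.Complex.RealDeriv
import Mathlib.Analysis.Asymptotics.Lemmas
import Mathlib.NumberTheory.Real.Irrational
import HarnessLib

/-!
# No ultralocal Ginsparg–Wilson fermions: discharge of the named fact (proofs only)

Second proof companion of `Literature/Barriers/QuantumFields/NoUltralocalGinspargWilson.lean`
(barrier catalogue D-0021, summit `QuantumFields`).  It proves
`Literature.Barriers.QuantumFields.NoUltralocalGinspargWilson_holds : NoUltralocalGinspargWilson`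
— Horváth's Theorem "Set `𝒰` is empty" (Phys. Rev. Lett. 81 (1998) 4063 = hep-lat/9808002) in
the vendored form: no finitely supported coupling `D : ℤ⁴ →₀ M₄(ℂ)` has a symbol that is
(β) hypercubic invariant, (γ) Ginsparg–Wilson and (δ) `i Σ_μ p_μ γ_μ + O(p²)` at `p → 0` — and
thereby makes the barrier fact and its corollary `NoUltralocalGinspargWilson.setU_empty`
unconditional.  No definition is declared; the lemmas live in
`NoUltralocalGinspargWilsonLemmas.lean`.

## The formal proof (Horváth's architecture, arXiv pp. 3-5)

Let `M(q) = D(q, q, 0, 0)` be the symbol on the diagonal (`latticeSymbol_diag_apply`: a finite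
sum `Σ_n e^{iq(n₀+n₁)} D_n`, Horváth's restriction `Ḡ^a(q)`, step (α), eq. (7)).
Equation numbers below are those of the arXiv version, as in the parent file.
* (β) The reflections of the axes `2`, `3` and the exchange `0 ↔ 1` fix `(q, q, 0, 0)`, so `M(q)`
  commutes with the three spinor matrices `H` of hypothesis (β); by Schur's lemma for the `γ_μ`
  these are scalar multiples of the explicit `R₂`, `R₃`, `X` of the lemma file, whence
  `M₀₁ = M₀₂ = 0`, `M₃₀ = -i M₀₃` (`diag_entries`; the row-`0` content of Horváth's reduced
  form (8), `D̄(q) = (1 - Ā)1 + iB̄(γ₁ + γ₂)`).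
* (γ) The `(0,0)` entry of the GW relation then reads `a² + i c² = 1` for `a = 1 - M₀₀`,
  `c = M₀₃` (Horváth's (9), `Ā² + 2B̄² = 1`), i.e. `f g = 1` for the trigonometric polynomials
  `f, g = a ± ζ c`, `ζ = (1 - i)/√2`, `ζ² = -i`.
* (Lemma) Hence `f(q) = α e^{ikq}` with `k ∈ ℤ`
  (`NoUltralocalGinspargWilson.trigPoly_eq_monomial_of_mul_eq_one`).
* (δ) Along the diagonal the continuum limit (6), in the form (10), gives
  `f(q) = 1 - i√2 q + O(q²)`, so `f(0) = 1`,
  `α = 1` and `f'(0) = -i√2`; but `f'(0) = iαk`, so `k = -√2`, contradicting `k ∈ ℤ`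
  (`irrational_sqrt_two`) — Horváth's "`2/K² = 1` … there is no positive integer `K`" (p. 4).
Hypothesis (ε) (no doublers) is absent from the vendored fact and unused, as in the printed proof
(closing remark, arXiv p. 5).

Sources: I. Horváth, hep-lat/9808002, Definition (Set `𝒰`), Theorem and Lemma, pp. 3-5;
W. Bietenholz, hep-lat/9901005, pp. 1-3.
-/

noncomputable section

open Complex Asymptotics Filter Polynomial
open scoped Topology

namespace Literature.Barriers.QuantumFields

open Literature.MathematicalPhysics.QuantumLattice

namespace NoUltralocalGinspargWilson

/-! ### The symbol on the diagonal `p = (q, q, 0, 0)` -/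

/-- The reflection of axis `2` fixes the diagonal momentum `(q, q, 0, 0)`.
[cite: Horvath1998, proof of the Theorem, step (β), arXiv p. 4] -/
theorem reflectAxis_two_diag (q : ℝ) : reflectAxis 2 ![q, q, 0, 0] = ![q, q, 0, 0] := by
  funext μ; fin_cases μ <;> simp [reflectAxis]

/-- The reflection of axis `3` fixes the diagonal momentum `(q, q, 0, 0)`.
[cite: Horvath1998, proof of the Theorem, step (β), arXiv p. 4] -/
theorem reflectAxis_three_diag (q : ℝ) : reflectAxis 3 ![q, q, 0, 0] = ![q, q, 0, 0] := by
  funext μ; fin_cases μ <;> simp [reflectAxis]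

/-- The exchange of the axes `0` and `1` fixes the diagonal momentum `(q, q, 0, 0)`.
[cite: Horvath1998, proof of the Theorem, step (β), arXiv p. 4] -/
theorem swapAxes_zero_one_diag (q : ℝ) : swapAxes 0 1 ![q, q, 0, 0] = ![q, q, 0, 0] := by
  funext μ; fin_cases μ <;> simp [swapAxes, Equiv.swap_apply_def]

/-- The symbol on the diagonal is the finite trigonometric sum
`D(q,q,0,0)_{ij} = Σ_{n ∈ supp D} e^{iq(n₀ + n₁)} (D_n)_{ij}` (Horváth's restriction `Ḡ^a(q)`
of the ultralocal form (4), a finite Fourier sum (7), step (α) of the proof).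
[cite: Horvath1998, eqs. (4) and (7), arXiv pp. 3-4] -/
theorem latticeSymbol_diag_apply (D : (Fin 4 → ℤ) →₀ Matrix (Fin 4) (Fin 4) ℂ) (q : ℝ)
    (i j : Fin 4) :
    latticeSymbol D ![q, q, 0, 0] i j =
      ∑ n ∈ D.support, cexp (I * q * ((n 0 + n 1 : ℤ) : ℂ)) * D n i j := by
  unfold latticeSymbol Finsupp.sum
  rw [Matrix.sum_apply]
  refine Finset.sum_congr rfl fun n _ => ?_
  dsimp only
  rw [Matrix.smul_apply, smul_eq_mul]
  congr 2
  simp [Fin.sum_univ_four]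
  ring

/-- **Step (β) of Horváth's proof.** For a hypercubic-invariant symbol, on the diagonal
`p = (q, q, 0, 0)` one has `D(p)₀₁ = D(p)₀₂ = 0` and `D(p)₃₀ = -i D(p)₀₃` (the row-`0` content
of the reduced form (8), `D̄(q) = (1 - Ā)1 + iB̄(γ₁ + γ₂)`, here `γ₀ + γ₁`): the three spinor
matrices of hypothesis (β) for `ℛ₂`, `ℛ₃`, `𝒳₀₁` commute with `D(p)` and are scalar multiples
of the explicit `R₂`, `R₃`, `X`.
[cite: Horvath1998, proof of the Theorem, step (β), eq. (8), arXiv p. 4] -/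
theorem diag_entries (D : (Fin 4 → ℤ) →₀ Matrix (Fin 4) (Fin 4) ℂ)
    (hβ : IsHypercubicInvariantSymbol (latticeSymbol D)) (q : ℝ) :
    latticeSymbol D ![q, q, 0, 0] 0 1 = 0 ∧ latticeSymbol D ![q, q, 0, 0] 0 2 = 0 ∧
      latticeSymbol D ![q, q, 0, 0] 3 0 = -I * latticeSymbol D ![q, q, 0, 0] 0 3 := by
  obtain ⟨hrefl, hswap⟩ := hβ
  obtain ⟨H₂, hH₂, hH₂γ, hH₂cov⟩ := hrefl 2
  obtain ⟨H₃, hH₃, hH₃γ, hH₃cov⟩ := hrefl 3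
  obtain ⟨H₁, hH₁, hH₁γ, hH₁cov⟩ := hswap 0 1 (by decide)
  set M := latticeSymbol D ![q, q, 0, 0] with hMdef
  have comm : ∀ {H : Matrix (Fin 4) (Fin 4) ℂ}, IsUnit H.det → M = H⁻¹ * M * H →
      M * H = H * M := by
    intro H hH h
    calc M * H = H * (H⁻¹ * M * H) := by
          rw [← Matrix.mul_assoc, ← Matrix.mul_assoc, Matrix.mul_nonsing_inv _ hH, Matrix.one_mul]
      _ = H * M := by rw [← h]
  have c₂ : M * H₂ = H₂ * M :=
    comm hH₂ (by simpa only [reflectAxis_two_diag] using hH₂cov ![q, q, 0, 0])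
  have c₃ : M * H₃ = H₃ * M :=
    comm hH₃ (by simpa only [reflectAxis_three_diag] using hH₃cov ![q, q, 0, 0])
  have c₁ : M * H₁ = H₁ * M :=
    comm hH₁ (by simpa only [swapAxes_zero_one_diag] using hH₁cov ![q, q, 0, 0])
  refine entries_of_commute_spinor M ?_ ?_ ?_
  · exact commute_of_mul_eq_smul_one hH₂
      (mul_eq_smul_one_of_conj (fun μ => if μ = 2 then -euclideanGamma μ else euclideanGamma μ)
        hH₂ hH₂γ reflTwo_rel) c₂
  · exact commute_of_mul_eq_smul_one hH₃
      (mul_eq_smul_one_of_conj (fun μ => if μ = 3 then -euclideanGamma μ else euclideanGamma μ)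
        hH₃ hH₃γ reflThree_rel) c₃
  · exact commute_of_mul_eq_smul_one hH₁
      (mul_eq_smul_one_of_conj (fun μ => euclideanGamma (Equiv.swap (0 : Fin 4) 1 μ))
        hH₁ hH₁γ swapZeroOne_rel) c₁

end NoUltralocalGinspargWilson

open NoUltralocalGinspargWilson in
/-- **No ultralocal Ginsparg–Wilson fermions (Horváth 1998, Theorem "Set `𝒰` is empty", with
the closing remark that (ε) is not needed): discharge of the named fact
`NoUltralocalGinspargWilson`.**  There is no finitely supported coupling `D : ℤ⁴ →₀ M₄(ℂ)` whose
symbol is hypercubic invariant (β), satisfies `Dγ₅ + γ₅D = Dγ₅D` (γ) and is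
`iΣ_μ p_μγ_μ + O(p²)` at `p → 0` (δ).  Proof as printed (arXiv pp. 3-5): restrict to the
diagonal `p = (q,q,0,0)`; (β) reduces the symbol there (`diag_entries`), (γ) becomes
`a² + ic² = (a + ζc)(a - ζc) = 1` with `ζ² = -i`, the Lemma makes `a + ζc = α e^{ikq}` with
`k ∈ ℤ` (`trigPoly_eq_monomial_of_mul_eq_one`), and (δ) forces `α = 1`, `ik = -i√2`, i.e.
`k² = 2` — Horváth's "`2/K² = 1`", impossible for an integer.
[cite: Horvath1998, Theorem and its proof, Lemma, closing remark, arXiv pp. 3-5] -/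
theorem NoUltralocalGinspargWilson_holds : NoUltralocalGinspargWilson := by
  rintro ⟨D, hβ, hγ, hδ⟩
  set d : ℝ → (Fin 4 → ℝ) := fun q => ![q, q, 0, 0] with hd
  set M : ℝ → Matrix (Fin 4) (Fin 4) ℂ := fun q => latticeSymbol D (d q) with hM
  set s : ℂ := (Real.sqrt 2 : ℂ) with hsdef
  have hs : s * s = 2 := by
    rw [hsdef, ← Complex.ofReal_mul, Real.mul_self_sqrt zero_le_two]; norm_num
  set ζ : ℂ := (1 - I) * s / 2 with hζ
  have hζ2 : ζ * ζ = -I := by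
    rw [hζ]; linear_combination ((1 - I) ^ 2 / 4) * hs + (1 / 2 : ℂ) * Complex.I_mul_I
  -- (β), (γ): the two trigonometric polynomials `f = a + ζ c`, `g = a - ζ c` with `f g = 1`
  set f : ℝ → ℂ := fun q => 1 - M q 0 0 + ζ * M q 0 3 with hf
  set g : ℝ → ℂ := fun q => 1 - M q 0 0 - ζ * M q 0 3 with hg
  have hfg : ∀ q, f q * g q = 1 := by
    intro q
    obtain ⟨z01, z02, h30⟩ := diag_entries D hβ q
    have e := gw_entry_zero_zero (M q) (hγ (d q))
    simp only [hf, hg]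
    linear_combination -e - (M q 1 0) * z01 + (M q 2 0) * z02 + (M q 0 3) * h30 -
      (M q 0 3) ^ 2 * hζ2
  -- (α) + Lemma: both are trigonometric polynomials, hence `f` is a monomial `α e^{ikq}`
  have hMsum : ∀ q i j,
      M q i j = ∑ n ∈ D.support, cexp (I * q * ((n 0 + n 1 : ℤ) : ℂ)) * D n i j :=
    fun q i j => latticeSymbol_diag_apply D q i j
  have hsum : ∀ (η : ℂ) (q : ℝ), 1 - M q 0 0 + η * M q 0 3 =
      1 + ∑ n ∈ D.support, cexp (I * q * ((n 0 + n 1 : ℤ) : ℂ)) * (-(D n 0 0) + η * D n 0 3) := by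
    intro η q
    rw [hMsum, hMsum, sub_eq_add_neg, add_assoc]
    congr 1
    rw [Finset.mul_sum, ← Finset.sum_neg_distrib, ← Finset.sum_add_distrib]
    exact Finset.sum_congr rfl fun n _ => by ring
  obtain ⟨N, P, hP⟩ := exists_polynomial_trigSum D.support (fun n => n 0 + n 1)
    (fun n => -(D n 0 0) + ζ * D n 0 3) 1
  obtain ⟨N', P', hP'⟩ := exists_polynomial_trigSum D.support (fun n => n 0 + n 1)
    (fun n => -(D n 0 0) + (-ζ) * D n 0 3) 1
  have hfP : ∀ q : ℝ, f q * cexp (I * q * N) = P.eval (cexp (I * q)) := fun q => by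
    rw [← hP q, ← hsum ζ q]
  have hgP : ∀ q : ℝ, g q * cexp (I * q * N') = P'.eval (cexp (I * q)) := fun q => by
    rw [← hP' q, ← hsum (-ζ) q]; simp only [hg, neg_mul, sub_eq_add_neg]
  obtain ⟨α, k, hfk⟩ := trigPoly_eq_monomial_of_mul_eq_one hfP hgP hfg
  -- (δ) on the diagonal: `f q = 1 - i √2 q + O(q²)`
  have hd0 : Tendsto d (𝓝 0) (𝓝 0) := by
    have hc : Continuous d := continuous_pi fun μ => by
      fin_cases μ <;> simp [hd] <;> first | exact continuous_id | exact continuous_const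
    have h0 : d 0 = 0 := by funext μ; fin_cases μ <;> simp [hd]
    simpa [h0] using hc.tendsto 0
  have hE : ∀ i j, (fun q : ℝ => (M q - ∑ μ, (I * (d q μ : ℂ)) • euclideanGamma μ) i j) =O[𝓝 0]
      fun q : ℝ => ‖q‖ ^ 2 := by
    intro i j
    refine ((hδ i j).comp_tendsto hd0).trans ?_
    refine (IsBigO.of_bound' (Eventually.of_forall fun q => ?_)).pow 2
    rw [norm_norm]
    refine (pi_norm_le_iff_of_nonneg (norm_nonneg _)).mpr fun μ => ?_
    fin_cases μ <;> simp [hd]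
  have hG : (fun q : ℝ => f q - 1 + I * s * q) =O[𝓝 0] fun q : ℝ => ‖q‖ ^ 2 := by
    have key : ∀ q : ℝ, f q - 1 + I * s * q =
        -((M q - ∑ μ, (I * (d q μ : ℂ)) • euclideanGamma μ) 0 0) +
          ζ * ((M q - ∑ μ, (I * (d q μ : ℂ)) • euclideanGamma μ) 0 3) := by
      intro q
      simp only [hf, hd, Matrix.sub_apply, Fin.sum_univ_four,
        euclideanGamma_zero, euclideanGamma_one, euclideanGamma_two, euclideanGamma_three]
      simp
      rw [hζ]
      linear_combination (I * q * s / 2 : ℂ) * Complex.I_mul_I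
    rw [show (fun q : ℝ => f q - 1 + I * s * q) = _ from funext key]
    exact (hE 0 0).neg_left.add ((hE 0 3).const_mul_left ζ)
  -- hence `f 0 = 1`, `α = 1`, and `f'(0) = -i √2 = i α k`
  have hf0 : f 0 = 1 := by
    have h' : (fun q : ℝ => f q - 1 + I * s * q) =O[𝓝 0] fun q : ℝ => ‖q - 0‖ ^ 2 := by
      simpa only [sub_zero] using hG
    have := h'.eq_zero_of_norm_pow two_ne_zero
    simp at this
    linear_combination this
  have hα : α = 1 := by
    have := hfk 0
    simp at this
    rw [← this, hf0]
  have hD1 : HasDerivAt f (-(I * s)) 0 := by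
    rw [hasDerivAt_iff_isLittleO]
    have h2 : (fun q : ℝ => f q - 1 + I * s * q) =o[𝓝 0] fun q : ℝ => q :=
      hG.trans_isLittleO (isLittleO_norm_pow_id one_lt_two)
    refine h2.congr' (Eventually.of_forall fun q => ?_) (Eventually.of_forall fun q => ?_)
    · simp only [hf0, sub_zero, Complex.real_smul]; ring
    · simp only [sub_zero]
  have hD2 : HasDerivAt f (α * (cexp (I * ((id (0 : ℝ) : ℝ) : ℂ) * k) * (I * 1 * k))) 0 := by
    have : f = fun q : ℝ => α * cexp (I * ((id q : ℝ) : ℂ) * k) := funext fun q => hfk q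
    rw [this]
    exact (((hasDerivAt_id (0 : ℝ)).ofReal_comp.const_mul I).mul_const (k : ℂ)).cexp.const_mul α
  have huniq := hD1.unique hD2
  simp [hα] at huniq
  -- so `k = -√2`, impossible for an integer
  have hk : (k : ℂ) = -s := by
    apply mul_left_cancel₀ I_ne_zero
    linear_combination -huniq
  have hk' : (k : ℝ) = -Real.sqrt 2 := by
    rw [hsdef] at hk
    exact_mod_cast hk
  exact irrational_sqrt_two.ne_int (-k) (by push_cast; linarith)

end Literature.Barriers.QuantumFields
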